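import Summits.BirchSwinnertonDyer.BirchSwinnertonDyer.Theorems.EisensteinPrimesMazurMCOnX1RankZeroInterludeResidualGL1UnrTransport
import Summits.BirchSwinnertonDyer.BirchSwinnertonDyer.Theorems.EisensteinPrimesMazurMCOnX1RankZeroInterludeResidualGL1Continuity
import Summits.BirchSwinnertonDyer.BirchSwinnertonDyer.Theorems.EisensteinPrimesMazurMCOnX1RankZeroInterludeResidualGL1Tame
import Summits.BirchSwinnertonDyer.BirchSwinnertonDyer.Theorems.EisensteinPrimesMazurMCOnX1RankZeroInterludeRoadBGL1Reduction
import Summits.BirchSwinnertonDyer.BirchSwinnertonDyer.Theorems.AlignedTransportAtTwoMainConjectureOfRankZeroBSDAtTwoFineRoadInfRes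
import Literature.NumberTheory.IwasawaTheory.ClassicalMuVanishesUnramifiedClasses
import Literature.NumberTheory.EllipticCurves.ZpExtensionRestrictCyclotomic
import Literature.NumberTheory.EllipticCurves.GreenbergVatsal2000.UnramifiedOutsideFinite
import Literature.NumberTheory.EllipticCurves.HeegnerPoints
import Literature.NumberTheory.ComplexMultiplication.TateHalfTransferInducedType
import Literature.NumberTheory.GaloisRepresentations.ArtinRestriction
import Literature.NumberTheory.GaloisRepresentations.AbsIntegersEquiv
import Literature.NumberTheory.GaloisRepresentations.GaloisSubgroups
import Literature.NumberTheory.GaloisRepresentations.DecompositionGroupOfCompletion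
import Literature.NumberTheory.Automorphic.LanglandsTetrahedral
import HarnessLib

/-!
# Crux `MazurMCOnX1RankZero` (item stmt-BirchSwinnertonDyer-19035), line `interlude_with_torsion`, road B input [Unr] FROM FERRERO–WASHINGTON:
# the trivialising abelian field `F = K·ℚ(η)` and the assembly `gl1InputUnramified_of_ferreroWashington` (part 2 of 2)

Cell `bsd-eis` (host `run/shared/lean/pub/bsd-eis/`), LEAD `cruxlead-19035` (g0); `--supports` stmt-BirchSwinnertonDyer-19035 as a
HELPER. Second half of the ideator bsd-idea-11 g17's workfile `Cruxes/MazurMCOnX1RankZero/Lines/interlude_roadB_UnrTransport_idea11g17.lean`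
(commit d411773f87eb; mathematics by that seat, verbatim; split at the 400-line limit; §1–§2 = `…InterludeResidualGL1UnrTransport`). §3: for a
quadratic `K/ℚ`, an order-`p` module `M` with `Γ_ℚ`-provenance and continuous `Γ_K`-action there is an ABELIAN number field `F ⊇ K`
(`F = ℚ̄^N`, `N = res_{K/ℚ}(ker(Γ_K → Aut M))`, `IsAbelianGalois ℚ F`) with `p ∤ [F : K] < p` on which `Γ_F` acts trivially
(`exists_trivialising_abelian_field`). §4: `κ.restrict F` is cyclotomic, FERRERO–WASHINGTON for `F` (named fact
`IwasawaTheory.ferreroWashington1979_classicalMuVanishes`) + `IwasawaTheory.classicalMuVanishes_finite_unramifiedClasses` give finiteness of the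
everywhere-unramified classes of `H¹(F_∞, M)`, and the transport `resField` of part 1 (unramified ↦ unramified, finite fibres) descends it
to `K_∞`: **`gl1InputUnramified_of_ferreroWashington : FW → U → RoadBHelpers.GL1InputUnramified`** (the type of the registered stub
`stub_gl1InputUnramified` of skeleton v10, token for token), `unrInput_of_ferreroWashington` (W2's `hUnr` form) and
`residualGL1FinitenessOdd_of_ferreroWashington_even : FW → U → [Even] → InterludeWithTorsion.ResidualGL1FinitenessOdd`. HONEST FRAMING:
CONDITIONAL on the two refereed named facts (Ferrero–Washington 1979; Washington §13 / Lang Ch. 5 for `μ = 0 ⟹ finitely many unramified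
classes`) — [Unr] is thereby PUB-by-name, not proved; [Even] (Greenberg LNM 1716 Lemma 5.9 over `K_∞`) stays displayed; nothing about
BSD, Mazur's main conjecture or IMC2 is asserted.
[cite: FerreroWashington1979, Theorem] [cite: Washington1997, §13.3, §13.5 (Prop. 13.28)] [cite: GreenbergLNM1716, §5, Lemma 5.9, proof of Prop. 5.10]
[cite: GreenbergVatsal2000, §2]
-/

noncomputable section

set_option linter.dupNamespace false
set_option autoImplicit false

open scoped NumberField Pointwise
open Field IsDedekindDomain
open Literature.NumberTheory.GaloisRepresentations
open Literature.NumberTheory.EllipticCurves Literature.NumberTheory.EllipticCurves.GreenbergSelmer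
open Literature.NumberTheory.EllipticCurves.GreenbergVatsal2000

universe u

namespace Summit.BirchSwinnertonDyer.BirchSwinnertonDyer.Theorems.InterludeWithTorsion.UnrTransport

/-! ## §3 The trivialising abelian field `F = ℚ̄^{res(ker(Γ_K → Aut M))}` -/

section AbelianFixedField

/-- For a field `k` of characteristic `0` and an open normal subgroup `N ⊴ Γ_k` containing all commutators, the fixed
field `k̄^N` is an abelian (finite Galois) extension of `k`: `Gal(k̄^N/k)` is a quotient of `Γ_k` (`resGal`) by
`Gal(k̄/k̄^N) = N` (`ker_resGal`, `fixingSubgroup_fixedField_of_isOpen`).  Stated for a general `k` so that every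
instance is Mathlib's canonical one. [cite: NeukirchANT1999, Ch. IV §1] [cite: MilneFT2022, Ch. 7 Thm. 7.12] -/
theorem isAbelianGalois_fixedField_of_commutator_mem {k : Type} [Field k] [CharZero k]
    (N : Subgroup (absoluteGaloisGroup k)) (hN : N.Normal) (hNopen : IsOpen (N : Set (absoluteGaloisGroup k)))
    (hcomm : ∀ τ₁ τ₂ : absoluteGaloisGroup k, τ₁ * τ₂ * τ₁⁻¹ * τ₂⁻¹ ∈ N) :
    IsAbelianGalois k (IntermediateField.fixedField N) := by
  have hfix : (IntermediateField.fixedField N).fixingSubgroup = N := fixingSubgroup_fixedField_of_isOpen N hNopen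
  haveI : IsGalois k (IntermediateField.fixedField N) :=
    (InfiniteGalois.normal_iff_isGalois _).mp (by rw [hfix]; exact hN)
  have hab : ∀ φ₁ φ₂ : (IntermediateField.fixedField N) ≃ₐ[k] (IntermediateField.fixedField N),
      φ₁ * φ₂ = φ₂ * φ₁ := fun φ₁ φ₂ ↦ by
    obtain ⟨τ₁, rfl⟩ := resGal_surjective (IntermediateField.fixedField N) φ₁
    obtain ⟨τ₂, rfl⟩ := resGal_surjective (IntermediateField.fixedField N) φ₂
    rw [← commutatorElement_eq_one_iff_mul_comm, commutatorElement_def, ← map_inv, ← map_inv, ← map_mul,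
      ← map_mul, ← map_mul, ← MonoidHom.mem_ker, ker_resGal, LocalWeilDatum.mem_galFixing_iff]
    intro x hx
    have hmem : τ₁ * τ₂ * τ₁⁻¹ * τ₂⁻¹ ∈ (IntermediateField.fixedField N).fixingSubgroup := by
      rw [hfix]; exact hcomm τ₁ τ₂
    exact (mem_fixingSubgroup_iff_forall_smul _ _).1 hmem ⟨x, hx⟩
  haveI : IsMulCommutative ((IntermediateField.fixedField N) ≃ₐ[k] (IntermediateField.fixedField N)) := ⟨⟨hab⟩⟩
  exact IsAbelianGalois.mk

end AbelianFixedField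

section Cutout

variable (K : Type) [Field K] [NumberField K] {p : ℕ} [Fact p.Prime]
variable (M : Type) [AddCommGroup M] [DistribMulAction (absoluteGaloisGroup ℚ) M]
  [DistribMulAction (absoluteGaloisGroup K) M] [TopologicalSpace M] [DiscreteTopology M]

/-- **The trivialising field.**  Let `K/ℚ` be quadratic, `M` of prime order `p` with a `Γ_ℚ`-action inducing the
`Γ_K`-action along `res_{K/ℚ}`, the latter continuous.  Then there is an ABELIAN number field `F ⊇ K` (namely
`F = ℚ̄^N`, `N = res_{K/ℚ}(S)`, `S = ker(Γ_K → Aut M)`) with `p ∤ [F:K]` and `res_{F/K}(Γ_F) = S`.  Steps: `res(Γ_K)` has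
index `2` in `Γ_ℚ`, hence is normal with commutators inside it (`Subgroup.mul_mem_iff_of_index_two`); `Γ_ℚ` acts on `M`
through commuting integer scalars (§1), so `N ⊴ Γ_ℚ` and `Γ_ℚ/N` is abelian; `N` is closed of index `2·#(Γ_K m₀) <
2p`, hence open; `F = ℚ̄^N` is finite Galois over `ℚ` with `Gal(F/ℚ)` a quotient of `Γ_ℚ/N` (`resGal`, `ker_resGal`);
`K ↪ F` because `N ≤ res(Γ_K) = Gal(ℚ̄/K₀)`, `K₀ ≅ K` (`exists_range_absGaloisRestrict_eq_fixingSubgroup`); and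
`res_{K/ℚ} ∘ res_{F/K}` is `res_{F/ℚ}` up to the inner automorphism `towerGaloisRep`
(`conj_absGaloisRestrict_absGaloisRestrict`), whose range is `N` (`exists_mem_range_absGaloisRestrict_fixedField_iff`).
[cite: NeukirchANT1999, Ch. IV §1] [cite: MilneFT2022, Ch. 7] [cite: Washington1997, §13.5] -/
theorem exists_trivialising_abelian_field (h2 : Module.finrank ℚ K = 2) (hcard : Nat.card M = p)
    (hM : ∀ (σ : absoluteGaloisGroup K) (m : M), σ • m = (absGaloisRestrict ℚ K σ) • m)
    (hcont : ∀ m : M, Continuous fun g : absoluteGaloisGroup K ↦ g • m) :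
    ∃ (F : Type) (_ : Field F) (_ : NumberField F) (_ : Algebra K F),
      IsAbelianGalois ℚ F ∧ ¬ p ∣ Module.finrank K F ∧
        ((absGaloisRestrict K F).range : Subgroup (absoluteGaloisGroup K)) =
          (MulAction.toPermHom (absoluteGaloisGroup K) M).ker := by
  classical
  have hp : p.Prime := Fact.out
  haveI : Finite M := Nat.finite_of_card_ne_zero (hcard ▸ hp.ne_zero)
  -- the kernel `S` of the action of `Γ_K`
  set S : Subgroup (absoluteGaloisGroup K) := (MulAction.toPermHom (absoluteGaloisGroup K) M).ker with hSdef
  have hmemS : ∀ g, g ∈ S ↔ ∀ m : M, g • m = m := fun g ↦ mem_ker_toPermHom_iff g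
  -- `res : Γ_K → Γ_ℚ`, injective with range `R` of index `2`
  set r := absGaloisRestrict ℚ K with hrdef
  have hrinj : Function.Injective r := absGaloisRestrict_injective ℚ K
  set R : Subgroup (absoluteGaloisGroup ℚ) := r.range with hRdef
  have hR2 : R.index = 2 := by
    rw [hRdef, hrdef, (Literature.NumberTheory.Automorphic.isOpen_range_absGaloisRestrict_and_index ℚ K).2, h2]
  haveI hRnormal : R.Normal := Subgroup.normal_of_index_eq_two hR2
  -- (A) `S` is the stabiliser of a generator: open, closed, of index `#(orbit) < p`
  obtain ⟨m₀, hm₀, hgen⟩ := exists_forall_exists_zsmul_eq (M := M) hcard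
  have hSstab : S = MulAction.stabilizer (absoluteGaloisGroup K) m₀ := by
    ext g
    rw [hmemS, MulAction.mem_stabilizer_iff]
    exact ⟨fun h ↦ h m₀, fun h m ↦ smul_eq_self_of_smul_generator_eq hgen h m⟩
  have hSopen : IsOpen (S : Set (absoluteGaloisGroup K)) := by
    rw [hSstab]
    exact (isOpen_discrete ({m₀} : Set M)).preimage (hcont m₀)
  have hSclosed : IsClosed (S : Set (absoluteGaloisGroup K)) := Subgroup.isClosed_of_isOpen S hSopen
  have hSidx : S.index = (MulAction.orbit (absoluteGaloisGroup K) m₀).ncard := by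
    rw [hSstab, MulAction.index_stabilizer]
  have horb_lt : (MulAction.orbit (absoluteGaloisGroup K) m₀).ncard < p := by
    have hsub : MulAction.orbit (absoluteGaloisGroup K) m₀ ⊆ ({0} : Set M)ᶜ := by
      rintro _ ⟨g, rfl⟩ h0
      apply hm₀
      have h0' : g • m₀ = 0 := h0
      have := congrArg (fun m : M ↦ g⁻¹ • m) h0'
      simpa using this
    have hc := Set.ncard_add_ncard_compl ({0} : Set M)
    rw [Set.ncard_singleton, hcard] at hc
    have hle := Set.ncard_le_ncard hsub (Set.toFinite _)
    omega
  have horb_pos : 0 < (MulAction.orbit (absoluteGaloisGroup K) m₀).ncard :=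
    (Set.ncard_pos (Set.toFinite _)).mpr ⟨m₀, MulAction.mem_orbit_self m₀⟩
  have hSpos : 0 < S.index := by rw [hSidx]; exact horb_pos
  have hndvd : ¬ p ∣ S.index := fun h ↦ absurd horb_lt (not_lt.mpr (hSidx ▸ Nat.le_of_dvd hSpos h))
  haveI hSfi : S.FiniteIndex := ⟨hSpos.ne'⟩
  -- (B) `N = res(S) ⊴ Γ_ℚ` with abelian quotient
  set N : Subgroup (absoluteGaloisGroup ℚ) := S.map r.toMonoidHom with hNdef
  have hmemN : ∀ x, x ∈ N ↔ ∃ s ∈ S, r s = x := fun x ↦ by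
    rw [hNdef, Subgroup.mem_map]
    rfl
  have hNR : N ≤ R := fun x hx ↦ by
    obtain ⟨s, -, rfl⟩ := (hmemN x).1 hx
    exact ⟨s, rfl⟩
  have hscal : ∀ τ : absoluteGaloisGroup ℚ, ∃ k : ℤ, ∀ m : M, τ • m = k • m := exists_int_forall_smul_eq hcard
  have hract : ∀ (s : absoluteGaloisGroup K) (m : M), r s • m = s • m := fun s m ↦ (hM s m).symm
  have hNnormal : N.Normal := ⟨fun n hn τ ↦ by
    obtain ⟨s, hs, rfl⟩ := (hmemN n).1 hn
    obtain ⟨s', hs'⟩ : τ * r s * τ⁻¹ ∈ R := hRnormal.conj_mem _ ⟨s, rfl⟩ τ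
    have hs'' : r s' = τ * r s * τ⁻¹ := hs'
    refine (hmemN _).2 ⟨s', (hmemS s').2 fun m ↦ ?_, hs''⟩
    rw [← hract s' m, hs'', mul_smul, mul_smul, hract, (hmemS s).1 hs, smul_inv_smul]⟩
  have hcommR : ∀ τ₁ τ₂ : absoluteGaloisGroup ℚ, τ₁ * τ₂ * τ₁⁻¹ * τ₂⁻¹ ∈ R := fun τ₁ τ₂ ↦ by
    simp only [Subgroup.mul_mem_iff_of_index_two hR2, inv_mem_iff]
    tauto
  have hcommN : ∀ τ₁ τ₂ : absoluteGaloisGroup ℚ, τ₁ * τ₂ * τ₁⁻¹ * τ₂⁻¹ ∈ N := fun τ₁ τ₂ ↦ by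
    obtain ⟨s, hs⟩ := hcommR τ₁ τ₂
    have hs' : r s = τ₁ * τ₂ * τ₁⁻¹ * τ₂⁻¹ := hs
    refine (hmemN _).2 ⟨s, (hmemS s).2 fun m ↦ ?_, hs'⟩
    obtain ⟨k₁, hk₁⟩ := hscal τ₁
    obtain ⟨k₂, hk₂⟩ := hscal τ₂
    have hc : ∀ x : M, (τ₁ * τ₂) • x = (τ₂ * τ₁) • x := fun x ↦ by
      rw [mul_smul, mul_smul, hk₂ x, hk₁ (k₂ • x), hk₁ x, hk₂ (k₁ • x)]
      exact zsmul_comm x k₂ k₁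
    rw [← hract s m, hs', show τ₁ * τ₂ * τ₁⁻¹ * τ₂⁻¹ = (τ₁ * τ₂) * (τ₂ * τ₁)⁻¹ by group, mul_smul, hc,
      smul_inv_smul]
  -- `N` is closed of finite index, hence open
  have hNclosed : IsClosed (N : Set (absoluteGaloisGroup ℚ)) := by
    have : (N : Set (absoluteGaloisGroup ℚ)) = r '' (S : Set (absoluteGaloisGroup K)) := by
      rw [hNdef, Subgroup.coe_map]
      rfl
    rw [this]
    exact (hSclosed.isCompact.image r.continuous).isClosed
  have hNidx : N.index = S.index * 2 := by
    rw [hNdef, S.index_map_of_injective (f := r.toMonoidHom) (fun a b h ↦ hrinj h), ← hR2]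
  haveI : N.FiniteIndex := ⟨by rw [hNidx]; exact Nat.mul_ne_zero hSpos.ne' two_ne_zero⟩
  have hNopen : IsOpen (N : Set (absoluteGaloisGroup ℚ)) := Subgroup.isOpen_of_isClosed_of_finiteIndex N hNclosed
  -- (C) the field `F = ℚ̄^N`: a number field, Galois and abelian over `ℚ`
  set F' : IntermediateField ℚ (AlgebraicClosure ℚ) := IntermediateField.fixedField N with hF'def
  haveI hF'fd : FiniteDimensional ℚ F' := finiteDimensional_fixedField_of_isOpen N hNopen
  have hF'rank : Module.finrank ℚ F' = N.index := finrank_fixedField_of_isOpen N hNopen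
  have hF'fix : F'.fixingSubgroup = N := fixingSubgroup_fixedField_of_isOpen N hNopen
  haveI hF'nf : NumberField F' := NumberField.mk
  have hAb := isAbelianGalois_fixedField_of_commutator_mem N hNnormal hNopen hcommN
  -- (D) `K ↪ F`: `N ≤ res(Γ_K) = Gal(ℚ̄/K₀)` with `K₀ ≅ K`
  obtain ⟨K₀, ⟨e⟩, hK₀⟩ := Literature.NumberTheory.Automorphic.exists_range_absGaloisRestrict_eq_fixingSubgroup ℚ K
  have hle : K₀ ≤ F' := (IntermediateField.le_iff_le N K₀).mpr (hK₀ ▸ hNR)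
  let f : K →ₐ[ℚ] F' := (IntermediateField.inclusion hle).comp e.toAlgHom
  letI hAlg : Algebra K F' := f.toRingHom.toAlgebra
  haveI : IsScalarTower ℚ K F' := IsScalarTower.of_algebraMap_eq fun q ↦ (f.commutes q).symm
  have hrankKF : Module.finrank K F' = S.index := by
    have h := Module.finrank_mul_finrank ℚ K F'
    rw [h2, hF'rank, hNidx] at h
    omega
  -- (E) `res_{F/K}(Γ_F) = S`
  set r' := absGaloisRestrict K F' with hr'def
  obtain ⟨g, hg⟩ := exists_mem_range_absGaloisRestrict_fixedField_iff N hNopen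
  have hrangeQ : ∀ γ, γ ∈ (absGaloisRestrict ℚ F').range ↔ γ ∈ N := fun γ ↦ by
    refine (hg γ).trans ⟨fun h ↦ ?_, fun h ↦ hNnormal.conj_mem' _ h g⟩
    have := hNnormal.conj_mem _ h g
    rwa [show g * (g⁻¹ * γ * g) * g⁻¹ = γ by group] at this
  set t := Literature.NumberTheory.ComplexMultiplication.towerGaloisRep K F' with htdef
  have hconj : ∀ γ' : absoluteGaloisGroup F', r (r' γ') = t⁻¹ * absGaloisRestrict ℚ F' γ' * t := fun γ' ↦ by
    have h : t * r (r' γ') * t⁻¹ = absGaloisRestrict ℚ F' γ' :=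
      Literature.NumberTheory.ComplexMultiplication.conj_absGaloisRestrict_absGaloisRestrict K F' γ'
    rw [← h]
    group
  have hrange : (r'.range : Subgroup (absoluteGaloisGroup K)) = S := by
    ext s
    constructor
    · rintro ⟨γ', rfl⟩
      have h1 : r (r' γ') ∈ N := by
        rw [hconj]
        exact hNnormal.conj_mem' _ ((hrangeQ _).1 ⟨γ', rfl⟩) t
      obtain ⟨s', hs', hrs'⟩ := (hmemN _).1 h1
      change r' γ' ∈ S
      rw [← hrinj hrs']
      exact hs'
    · intro hs
      have h1 : t * r s * t⁻¹ ∈ (absGaloisRestrict ℚ F').range :=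
        (hrangeQ _).2 (hNnormal.conj_mem _ ((hmemN _).2 ⟨s, hs, rfl⟩) t)
      obtain ⟨γ', hγ'⟩ := h1
      have hγ'' : absGaloisRestrict ℚ F' γ' = t * r s * t⁻¹ := hγ'
      refine ⟨γ', hrinj ?_⟩
      change r (r' γ') = r s
      rw [hconj, hγ'']
      group
  refine ⟨F', inferInstance, inferInstance, hAlg, hAb, ?_, hrange⟩
  rw [hrankKF]
  exact hndvd

end Cutout

/-! ## §4 Assembly: `[Unr]` from Ferrero–Washington -/

section Assembly

open Literature.NumberTheory.IwasawaTheory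

/-- **[Unr] in the continuous case.**  For `K/ℚ` quadratic, `p` odd, `κ` the cyclotomic `ℤ_p`-extension and `M` of
order `p` carrying a `Γ_ℚ`-action that induces a CONTINUOUS `Γ_K`-action: the everywhere-unramified classes of
`H¹(K_∞, M)` (all conjugates in every Greenberg–Vatsal `unramifiedKer`) form a finite set — GRANTED the two printed
theorems `ferreroWashington1979_classicalMuVanishes` and `classicalMuVanishes_finite_unramifiedClasses`.  Proof: over
the abelian trivialising field `F` of §3, `κ_F = κ ∘ res` is the cyclotomic `ℤ_p`-extension (`isCyclotomic_restrict`,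
`p ∤ [F:K]`), `Γ_F` acts trivially, so the two facts give finiteness upstairs; §2 brings it down.
[cite: FerreroWashington1979, Theorem] [cite: Washington1997, §13.5 Prop. 13.28] [cite: GreenbergVatsal2000, §2] -/
theorem finite_everywhereUnramified_of_continuous
    (hFW : ferreroWashington1979_classicalMuVanishes) (hU : classicalMuVanishes_finite_unramifiedClasses)
    (K : Type) [Field K] [NumberField K] (h2 : Module.finrank ℚ K = 2)
    (p : ℕ) [Fact p.Prime] (hp2 : p ≠ 2) (κ : ZpExtension K p) (hκ : κ.IsCyclotomic)
    (M : Type) [AddCommGroup M] [DistribMulAction (absoluteGaloisGroup ℚ) M]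
    [DistribMulAction (absoluteGaloisGroup K) M] [TopologicalSpace M] [DiscreteTopology M]
    (hcard : Nat.card M = p)
    (hM : ∀ (σ : absoluteGaloisGroup K) (m : M), σ • m = (absGaloisRestrict ℚ K σ) • m)
    (hcont : ∀ m : M, Continuous fun g : absoluteGaloisGroup K ↦ g • m) :
    {c : subgroupH1 κ.kerSubgroup M | ∀ (v : HeightOneSpectrum (𝓞 K)) (σ : absoluteGaloisGroup K),
      conjH1 κ.kerSubgroup M σ c ∈ GreenbergVatsal2000.unramifiedKer κ.kerSubgroup M v}.Finite := by
  classical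
  have hp : p.Prime := Fact.out
  haveI : Finite M := Nat.finite_of_card_ne_zero (hcard ▸ hp.ne_zero)
  obtain ⟨F, _instF, _instNF, _instAlg, hAb, hndvd, hrange⟩ :=
    exists_trivialising_abelian_field K M h2 hcard hM hcont
  haveI := hAb
  -- `Γ_F` acts on `M` through `res : Γ_F → Γ_K`, trivially
  letI : DistribMulAction (absoluteGaloisGroup F) M :=
    DistribMulAction.compHom M (absGaloisRestrict K F).toMonoidHom
  have hMF : ∀ (σ : absoluteGaloisGroup F) (m : M), σ • m = (absGaloisRestrict K F σ) • m := fun _ _ ↦ rfl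
  have htriv : ∀ (σ : absoluteGaloisGroup F) (m : M), σ • m = m := fun σ m ↦ by
    have hσ : absGaloisRestrict K F σ ∈ (MulAction.toPermHom (absoluteGaloisGroup K) M).ker := by
      rw [← hrange]
      exact ⟨σ, rfl⟩
    rw [hMF]
    exact (mem_ker_toPermHom_iff _).1 hσ m
  -- `κ_F = κ ∘ res` is the cyclotomic `ℤ_p`-extension of `F`
  have hs := ZpExtension.surjective_comp_absGaloisRestrict_of_not_dvd_finrank κ F hndvd
  have hκ' : (κ.restrict F hs).IsCyclotomic := ZpExtension.isCyclotomic_restrict κ hκ F hs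
  -- Ferrero–Washington upstairs
  have hT := hU F p (κ.restrict F hs) (Or.inl (hp.odd_of_ne_two hp2)) (hFW F p (κ.restrict F hs) hκ') M
    ⟨1, by rw [pow_one, hcard]⟩ htriv
  -- transport down
  have hnormal : ((absGaloisRestrict K F).range : Subgroup (absoluteGaloisGroup K)).Normal := by
    rw [hrange]
    infer_instance
  exact (finite_preimage_resField κ hs M hMF hnormal hcont hT).subset fun c hc w σ' ↦
    resField_mem_unramifiedKer κ hs M hMF c hc w σ'

/-- **[Unr] from Ferrero–Washington.**  The hypothesis `hUnr` of
`InterludeWithTorsion.residualGL1FinitenessOdd_of_unr_even'` (`Theorems/…InterludeResidualGL1Tame`), token for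
token, follows from the two printed theorems of classical Iwasawa theory filed as named facts in
`Literature/NumberTheory/IwasawaTheory`: Ferrero–Washington `μ = 0` for abelian fields and cyclotomic `ℤ_p`-extensions
(`ferreroWashington1979_classicalMuVanishes`) and "`μ = 0` ⇒ the everywhere-unramified classes of `H¹(K_∞, M)` are
finite for a trivial `p`-primary `M`" (`classicalMuVanishes_finite_unramifiedClasses`).  The character is GENERAL: the
abelian field is `F = K·ℚ(η)` of §3.  If `Γ_K` does not act continuously, `H¹(K_∞, M) = 0`
(`discreteH1_eq_zero_of_not_continuous`, `continuous_smul_of_continuous_smul_kerSubgroup`).  CONDITIONAL on the two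
named facts (hypotheses); nothing else. [cite: FerreroWashington1979, Theorem] [cite: Washington1997, §7.5 Thm. 7.15,
§13.5 Prop. 13.28] [cite: Greenberg1999, §5 Lemma 5.9 (context)] -/
theorem unrInput_of_ferreroWashington
    (hFW : ferreroWashington1979_classicalMuVanishes) (hU : classicalMuVanishes_finite_unramifiedClasses) :
    ∀ (K : Type) [Field K] [NumberField K], IsImaginaryQuadratic K →
      ∀ (p : ℕ) [Fact p.Prime], p ≠ 2 →
      ∀ (κ : ZpExtension K p), κ.IsCyclotomic →
      ∀ (M : Type) [AddCommGroup M] [DistribMulAction (absoluteGaloisGroup ℚ) M]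
        [DistribMulAction (absoluteGaloisGroup K) M] [TopologicalSpace M] [DiscreteTopology M],
        Nat.card M = p →
        (∀ (σ : absoluteGaloisGroup K) (m : M), σ • m = (absGaloisRestrict ℚ K σ) • m) →
        {c : subgroupH1 κ.kerSubgroup M | ∀ (v : HeightOneSpectrum (𝓞 K)) (σ : absoluteGaloisGroup K),
          conjH1 κ.kerSubgroup M σ c ∈ GreenbergVatsal2000.unramifiedKer κ.kerSubgroup M v}.Finite := by
  intro K _ _ hK p _ hp2 κ hκ M _ _ _ _ _ hcard hM
  classical
  have hp : p.Prime := Fact.out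
  haveI : Finite M := Nat.finite_of_card_ne_zero (hcard ▸ hp.ne_zero)
  by_cases hcont : ∀ m : M, Continuous fun g : absoluteGaloisGroup K ↦ g • m
  · exact finite_everywhereUnramified_of_continuous hFW hU K hK.1 p hp2 κ hκ M hcard hM hcont
  · have hH : ¬ ∀ m : M, Continuous fun g : κ.kerSubgroup ↦ g • m :=
      fun h ↦ hcont fun m ↦ continuous_smul_of_continuous_smul_kerSubgroup κ h m
    have hzero : ∀ c : subgroupH1 κ.kerSubgroup M, c = 0 := fun c ↦
      discreteH1_eq_zero_of_not_continuous (G := κ.kerSubgroup) (M := M) (hcard.symm ▸ hp) hH c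
    exact (Set.finite_singleton (0 : subgroupH1 κ.kerSubgroup M)).subset fun c _ ↦ hzero c

/-- **v10 stub `[Unr]` BY NAME, modulo PUB.**  `RoadBHelpers.GL1InputUnramified` ([P1] of
`Theorems/…InterludeRoadBGL1Reduction`, = the type of the registered stub `stub_gl1InputUnramified` of skeleton v10) from the two
named facts; dictionary `RoadBHelpers.mem_everywhereUnramified_iff`.  CONDITIONAL on the two displayed published theorems.
[cite: FerreroWashington1979, Theorem] [cite: Washington1997, §13.5 Prop. 13.28] -/
theorem gl1InputUnramified_of_ferreroWashington
    (hFW : ferreroWashington1979_classicalMuVanishes) (hU : classicalMuVanishes_finite_unramifiedClasses) :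
    RoadBHelpers.GL1InputUnramified := by
  intro K _ _ hK p _ hp2 κ hκ M _ _ _ _ _ hcard hM
  exact (unrInput_of_ferreroWashington hFW hU K hK p hp2 κ hκ M hcard hM).subset fun c hc ↦
    (RoadBHelpers.mem_everywhereUnramified_iff c).1 hc

/-- **(B3) BY NAME from PUB ∧ [Even].**  `InterludeWithTorsion.ResidualGL1FinitenessOdd` (the registered (B3) currency of
`Theorems/…InterludeDefs`) from the two named facts of classical Iwasawa theory and W2's `[Even]` input (Greenberg LNM 1716
Lemma 5.9 over `K_∞`, via `cycSwapH1`), through `residualGL1FinitenessOdd_of_unr_even'` (`Theorems/…InterludeResidualGL1Tame`).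
(B3) is REDUCED to PUB ∧ [Even], not proved. [cite: GreenbergLNM1716, §5 Lemma 5.9] [cite: FerreroWashington1979, Theorem] -/
theorem residualGL1FinitenessOdd_of_ferreroWashington_even
    (hFW : ferreroWashington1979_classicalMuVanishes) (hU : classicalMuVanishes_finite_unramifiedClasses)
    (hEven : ∀ (K : Type) [Field K] [NumberField K] [IsGalois ℚ K], IsImaginaryQuadratic K →
      ∀ (p : ℕ) [Fact p.Prime], p ≠ 2 →
      ∀ (κ : ZpExtension K p) (hκ : κ.IsCyclotomic),
      ∀ (M : Type) [AddCommGroup M] [DistribMulAction (absoluteGaloisGroup ℚ) M]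
        [DistribMulAction (absoluteGaloisGroup K) M] [TopologicalSpace M] [DiscreteTopology M],
        Nat.card M = p →
        ∀ (hM : ∀ (σ : absoluteGaloisGroup K) (m : M), σ • m = (absGaloisRestrict ℚ K σ) • m),
        ∃ τ : absoluteGaloisGroup ℚ, τ ∉ Set.range (absGaloisRestrict ℚ K) ∧
          (((fun c ↦ c + cycSwapH1 κ hκ M hM τ c) ''
              (unramifiedOutside κ.kerSubgroup M p ∅ : Set (subgroupH1 κ.kerSubgroup M))).Finite ∨
            ((fun c ↦ c - cycSwapH1 κ hκ M hM τ c) ''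
              (unramifiedOutside κ.kerSubgroup M p ∅ : Set (subgroupH1 κ.kerSubgroup M))).Finite)) :
    InterludeWithTorsion.ResidualGL1FinitenessOdd :=
  residualGL1FinitenessOdd_of_unr_even' (unrInput_of_ferreroWashington hFW hU) hEven

end Assembly

end Summit.BirchSwinnertonDyer.BirchSwinnertonDyer.Theorems.InterludeWithTorsion.UnrTransport
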